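import Literature.Geometry.Lorentzian.TeukolskyRealAxisModeStabilityProofs
import HarnessLib

/-!
# The outgoing expansion at infinity: explicit partial sums, the remainder and its derivative
# (Teixeira da Costa 2020, Def. 2.3 / Lemma 2.2, as used in §3.2.3)

Part of the proof programme for the named fact
`Literature.Geometry.Lorentzian.Kerr.Costa2019_realAxisModeStability` (R. Teixeira da Costa,
Commun. Math. Phys. 378 (2020) 705–781 = arXiv:1910.02854 [Costa2019], Thm. 4.1). The outgoing
condition at `𝓘⁺` (`Kerr.IsOutgoingAtInfinity`) gives, for every order `N`, an explicit partial
sum `P_N(r) = e^{iωr} r^{2iMω} Σ_{k≤N} cₖ r^{−2s−k−1}` (`Costa2019.outgoingP`) with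
`R − P_N = O(r^{−2s−N−2})`. The source differentiates such expansions termwise (it treats `R` as
an asymptotic series of the ODE); from the definition alone we obtain the derivative information
actually needed downstream — `R' − P_N' = O(r^{(−2s−N−2+K)/2})` with `K` independent of `N`
(`Costa2019.outgoing_remainder_bounds`) — by Landau's inequality
(`Costa2019.norm_deriv_le_landau`) on intervals `[r, r + h]`, `h = r^{(a−K)/2}`, combining the
smallness of `R − P_N` with the merely polynomial size of `(R − P_N)'' = pR' + qR − P_N''`
(energy growth, `Costa2019.radial_energy_growth`). Everything is proved; no named facts.

## References
* R. Teixeira da Costa, CMP 378 (2020) 705–781, arXiv:1910.02854, Def. 2.3, Lemma 2.2, §3.2.3.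
  [Costa2019]
-/

noncomputable section

open Complex Set Filter Topology

namespace Literature.Geometry.Lorentzian.Kerr

namespace Costa2019

/-! ### Derivatives of a classical solution as `deriv`, and their polynomial growth -/

/-- For a classical radial solution, `deriv R` and `deriv (deriv R)` are the derivatives on
`(r₊, ∞)`, the second one is continuous there, and `R'' = p R' + q R` with the normal-form
coefficients of `Costa2019.radial_normalForm_bounds`. [folklore] -/
theorem deriv_facts_of_isRadialTeukolskySolution {M a s ω m lam : ℝ} (ha : |a| ≤ M) {R : ℝ → ℂ}
    (hsol : IsRadialTeukolskySolution M a s ω m lam R) :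
    (∀ r, rPlus M a < r → HasDerivAt R (deriv R r) r) ∧
      (∀ r, rPlus M a < r → HasDerivAt (deriv R) (deriv (deriv R) r) r) ∧
      ContinuousOn (deriv (deriv R)) (Ioi (rPlus M a)) ∧
      ∀ R' R'' : ℝ → ℂ, (∀ r, rPlus M a < r → HasDerivAt R (R' r) r ∧ HasDerivAt R' (R'' r) r) →
        ∀ r, rPlus M a < r → deriv R r = R' r ∧ deriv (deriv R) r = R'' r := by
  have hcd := contDiffOn_of_isRadialTeukolskySolution ha hsol
  have hopen : IsOpen (Ioi (rPlus M a)) := isOpen_Ioi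
  have htop : ((⊤ : ℕ∞) : WithTop ℕ∞) ≠ 0 := by simp
  have h1 : ∀ r, rPlus M a < r → HasDerivAt R (deriv R r) r := fun r hr =>
    ((hcd.differentiableOn htop r hr).differentiableAt (hopen.mem_nhds hr)).hasDerivAt
  have hcd1 : ContDiffOn ℝ ((⊤ : ℕ∞) : WithTop ℕ∞) (deriv R) (Ioi (rPlus M a)) :=
    hcd.deriv_of_isOpen hopen (by simp)
  have h2 : ∀ r, rPlus M a < r → HasDerivAt (deriv R) (deriv (deriv R) r) r := fun r hr =>
    ((hcd1.differentiableOn htop r hr).differentiableAt (hopen.mem_nhds hr)).hasDerivAt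
  have h3 : ContinuousOn (deriv (deriv R)) (Ioi (rPlus M a)) :=
    hcd1.continuousOn_deriv_of_isOpen hopen (by simp)
  refine ⟨h1, h2, h3, fun R' R'' hR r hr => ?_⟩
  have e1 : ∀ t, rPlus M a < t → deriv R t = R' t := fun t ht => (h1 t ht).unique (hR t ht).1
  refine ⟨e1 r hr, ?_⟩
  have hloc : deriv R =ᶠ[𝓝 r] R' := by
    filter_upwards [hopen.mem_nhds hr] with t ht using e1 t ht
  rw [hloc.deriv_eq]
  exact (hR r hr).2.deriv

/-- **Polynomial growth of `R` and `R'`** for a classical radial solution (`ω ≠ 0`): there are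
`X ≥ r₊ + 1`, `X ≥ 1`, `C ≥ 0` and `p ≥ 0` with `|R(r)|, |R'(r)| ≤ C r^p` for `r ≥ X`.
[cite: Costa2019, §2.2.3] -/
theorem exists_rpow_bound_of_isRadialTeukolskySolution {M a : ℝ} (hM : 0 < M) (ha : |a| < M)
    {ω : ℝ} (hω : ω ≠ 0) {s m lam : ℝ} {R R₁ : ℝ → ℂ}
    (hsol : IsRadialTeukolskySolution M a s ω m lam R)
    (hR₁ : ∀ r, rPlus M a < r → HasDerivAt R (R₁ r) r) :
    ∃ X C p : ℝ, rPlus M a + 1 ≤ X ∧ 1 ≤ X ∧ 0 ≤ C ∧ 0 ≤ p ∧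
      ∀ r, X ≤ r → ‖R r‖ ≤ C * r ^ p ∧ ‖R₁ r‖ ≤ C * r ^ p := by
  obtain ⟨X, κ, hXr, hX1, hκ, h⟩ := radial_energy_growth hM ha hω s m lam
  have hX0 : 0 < X := one_pos.trans_le hX1
  set E : ℝ := ‖R₁ X‖ ^ 2 + ω ^ 2 * ‖R X‖ ^ 2 with hE
  have hE0 : 0 ≤ E := by positivity
  have hωpos : 0 < |ω| := abs_pos.2 hω
  refine ⟨max X (rPlus M a + 1), Real.sqrt E * (1 + |ω|⁻¹), κ / 2, le_max_right _ _,
    hX1.trans (le_max_left _ _), by positivity, by linarith, fun r hr => ?_⟩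
  have hrX : X ≤ r := (le_max_left _ _).trans hr
  have hr0 : 0 < r := hX0.trans_le hrX
  have hen := h R R₁ hsol hR₁ r hrX
  have hle : (r / X) ^ κ ≤ r ^ κ :=
    Real.rpow_le_rpow (by positivity) (div_le_self hr0.le hX1) hκ
  have hsq : r ^ κ = (r ^ (κ / 2)) ^ 2 := by
    rw [← Real.rpow_natCast, ← Real.rpow_mul hr0.le]; norm_num
  set B : ℝ := Real.sqrt E * r ^ (κ / 2) with hB
  have hB0 : 0 ≤ B := by positivity
  have hEr : ‖R₁ r‖ ^ 2 + ω ^ 2 * ‖R r‖ ^ 2 ≤ B ^ 2 := by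
    rw [hB, mul_pow, Real.sq_sqrt hE0, ← hsq]
    exact hen.trans (mul_le_mul_of_nonneg_left hle hE0)
  have h1 : ‖R₁ r‖ ≤ B := by
    refine (pow_le_pow_iff_left₀ (norm_nonneg _) hB0 two_ne_zero).1 ?_
    nlinarith [sq_nonneg (ω * ‖R r‖)]
  have h2 : |ω| * ‖R r‖ ≤ B := by
    refine (pow_le_pow_iff_left₀ (by positivity) hB0 two_ne_zero).1 ?_
    rw [mul_pow, sq_abs]
    nlinarith [sq_nonneg ‖R₁ r‖]
  have h3 : ‖R r‖ ≤ B * |ω|⁻¹ := by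
    rw [← div_eq_mul_inv, le_div_iff₀ hωpos]; linarith
  have hB1 : B ≤ Real.sqrt E * (1 + |ω|⁻¹) * r ^ (κ / 2) := by
    rw [hB]
    have : 0 ≤ Real.sqrt E * r ^ (κ / 2) * |ω|⁻¹ := by positivity
    nlinarith
  have hB2 : B * |ω|⁻¹ ≤ Real.sqrt E * (1 + |ω|⁻¹) * r ^ (κ / 2) := by
    rw [hB]
    have : 0 ≤ Real.sqrt E * r ^ (κ / 2) := by positivity
    nlinarith
  exact ⟨h3.trans hB2, h1.trans hB1⟩

/-! ### The explicit partial sums of the outgoing expansion -/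

/-- The oscillatory factor `e^{iωr + 2iMω log r} = e^{iωr} r^{2iMω}` of the outgoing expansion.
[cite: Costa2019, Def. 2.3] -/
def outgoingPhase (M ω : ℝ) (r : ℝ) : ℂ :=
  Complex.exp (I * ω * r + 2 * I * M * ω * Real.log r)

/-- The amplitude partial sum `π_N(r) = Σ_{k≤N} cₖ r^{−2s−k−1}`. [cite: Costa2019, Def. 2.3] -/
def outgoingSum (s : ℝ) (c : ℕ → ℂ) (N : ℕ) (r : ℝ) : ℂ :=
  ∑ k ∈ Finset.range (N + 1), c k * ((r ^ (-(2 * s) - (k : ℝ) - 1) : ℝ) : ℂ)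

/-- `π_N'(r) = Σ cₖ (−2s−k−1) r^{−2s−k−2}`. [cite: Costa2019, Def. 2.3] -/
def outgoingSumDeriv (s : ℝ) (c : ℕ → ℂ) (N : ℕ) (r : ℝ) : ℂ :=
  ∑ k ∈ Finset.range (N + 1), c k * (((-(2 * s) - (k : ℝ) - 1) * r ^ (-(2 * s) - (k : ℝ) - 2) : ℝ) : ℂ)

/-- `π_N''(r) = Σ cₖ (−2s−k−1)(−2s−k−2) r^{−2s−k−3}`. [cite: Costa2019, Def. 2.3] -/
def outgoingSumDeriv2 (s : ℝ) (c : ℕ → ℂ) (N : ℕ) (r : ℝ) : ℂ :=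
  ∑ k ∈ Finset.range (N + 1), c k *
    (((-(2 * s) - (k : ℝ) - 1) * (-(2 * s) - (k : ℝ) - 2) * r ^ (-(2 * s) - (k : ℝ) - 3) : ℝ) : ℂ)

/-- The partial sum `P_N = e^{iωr} r^{2iMω} π_N` of the outgoing expansion (the comparison function
of `Kerr.IsOutgoingAtInfinity`). [cite: Costa2019, Def. 2.3] -/
def outgoingP (M s ω : ℝ) (c : ℕ → ℂ) (N : ℕ) (r : ℝ) : ℂ :=
  outgoingPhase M ω r * outgoingSum s c N r

/-- `P_N' = e^{iωr} r^{2iMω} [ (iω + 2iMω/r) π_N + π_N' ]`. [cite: Costa2019, §3.2.3 (p. 36)] -/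
def outgoingPDeriv (M s ω : ℝ) (c : ℕ → ℂ) (N : ℕ) (r : ℝ) : ℂ :=
  outgoingPhase M ω r * ((I * ω + 2 * I * M * ω * (r : ℂ)⁻¹) * outgoingSum s c N r +
    outgoingSumDeriv s c N r)

/-- `P_N'' = e^{iωr} r^{2iMω} [ ((iω + 2iMω/r)² − 2iMω/r²) π_N + 2(iω + 2iMω/r) π_N' + π_N'' ]`.
[cite: Costa2019, §3.2.3 (p. 36)] -/
def outgoingPDeriv2 (M s ω : ℝ) (c : ℕ → ℂ) (N : ℕ) (r : ℝ) : ℂ :=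
  outgoingPhase M ω r * (((I * ω + 2 * I * M * ω * (r : ℂ)⁻¹) ^ 2 - 2 * I * M * ω * ((r : ℂ)⁻¹) ^ 2) *
      outgoingSum s c N r +
    2 * (I * ω + 2 * I * M * ω * (r : ℂ)⁻¹) * outgoingSumDeriv s c N r + outgoingSumDeriv2 s c N r)

/-- `outgoingP` is the comparison function appearing in `Kerr.IsOutgoingAtInfinity`. [folklore] -/
theorem outgoingP_eq (M s ω : ℝ) (c : ℕ → ℂ) (N : ℕ) (r : ℝ) :
    outgoingP M s ω c N r = Complex.exp (I * ω * r + 2 * I * M * ω * Real.log r) *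
      ∑ k ∈ Finset.range (N + 1), c k * ((r ^ (-(2 * s) - (k : ℝ) - 1) : ℝ) : ℂ) := rfl

/-- `d/dr e^{iωr + 2iMω log r} = e^{…} (iω + 2iMω/r)`, `r > 0`. [folklore] -/
theorem hasDerivAt_outgoingPhase (M ω : ℝ) {r : ℝ} (hr : 0 < r) :
    HasDerivAt (outgoingPhase M ω) (outgoingPhase M ω r * (I * ω + 2 * I * M * ω * (r : ℂ)⁻¹)) r := by
  have h0 : HasDerivAt (fun x : ℝ => (x : ℂ)) 1 r := by simpa using (hasDerivAt_id r).ofReal_comp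
  have hlog : HasDerivAt (fun x : ℝ => ((Real.log x : ℝ) : ℂ)) ((r⁻¹ : ℝ) : ℂ) r :=
    (Real.hasDerivAt_log hr.ne').ofReal_comp
  have h1 : HasDerivAt (fun x : ℝ => I * ω * (x : ℂ) + 2 * I * M * ω * ((Real.log x : ℝ) : ℂ))
      (I * ω * 1 + 2 * I * M * ω * ((r⁻¹ : ℝ) : ℂ)) r :=
    (h0.const_mul (I * ω)).add (hlog.const_mul (2 * I * M * ω))
  have h2 := h1.cexp
  refine h2.congr_deriv ?_
  unfold outgoingPhase
  push_cast
  ring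

/-- Derivative of a real power cast to `ℂ`: `d/dr r^q = q r^{q−1}` (`r > 0`). [folklore] -/
theorem hasDerivAt_ofReal_rpow {r : ℝ} (hr : 0 < r) (q : ℝ) :
    HasDerivAt (fun x : ℝ => ((x ^ q : ℝ) : ℂ)) (((q * r ^ (q - 1)) : ℝ) : ℂ) r := by
  have h := (Real.hasDerivAt_rpow_const (x := r) (p := q) (Or.inl hr.ne')).ofReal_comp
  simpa using h

/-- `π_N' ` is the derivative of `π_N` (`r > 0`). [folklore] -/
theorem hasDerivAt_outgoingSum (s : ℝ) (c : ℕ → ℂ) (N : ℕ) {r : ℝ} (hr : 0 < r) :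
    HasDerivAt (outgoingSum s c N) (outgoingSumDeriv s c N r) r := by
  unfold outgoingSum outgoingSumDeriv
  refine HasDerivAt.fun_sum fun k _ => ?_
  have h := (hasDerivAt_ofReal_rpow hr (-(2 * s) - (k : ℝ) - 1)).const_mul (c k)
  refine h.congr_deriv ?_
  congr 2
  ring_nf

/-- `π_N''` is the derivative of `π_N'` (`r > 0`). [folklore] -/
theorem hasDerivAt_outgoingSumDeriv (s : ℝ) (c : ℕ → ℂ) (N : ℕ) {r : ℝ} (hr : 0 < r) :
    HasDerivAt (outgoingSumDeriv s c N) (outgoingSumDeriv2 s c N r) r := by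
  unfold outgoingSumDeriv outgoingSumDeriv2
  refine HasDerivAt.fun_sum fun k _ => ?_
  have h := ((hasDerivAt_ofReal_rpow hr (-(2 * s) - (k : ℝ) - 2)).const_mul
    (((-(2 * s) - (k : ℝ) - 1 : ℝ) : ℂ))).const_mul (c k)
  have hfun : (fun x : ℝ => c k * ((((-(2 * s) - (k : ℝ) - 1) * x ^ (-(2 * s) - (k : ℝ) - 2) : ℝ) : ℂ))) =
      fun x : ℝ => c k * ((((-(2 * s) - (k : ℝ) - 1 : ℝ) : ℂ)) * ((x ^ (-(2 * s) - (k : ℝ) - 2) : ℝ) : ℂ)) := by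
    funext x; push_cast; ring
  rw [hfun]
  refine h.congr_deriv ?_
  push_cast
  ring_nf

/-- `P_N' ` is the derivative of `P_N` (`r > 0`). [cite: Costa2019, §3.2.3] -/
theorem hasDerivAt_outgoingP (M s ω : ℝ) (c : ℕ → ℂ) (N : ℕ) {r : ℝ} (hr : 0 < r) :
    HasDerivAt (outgoingP M s ω c N) (outgoingPDeriv M s ω c N r) r := by
  have h := (hasDerivAt_outgoingPhase M ω hr).mul (hasDerivAt_outgoingSum s c N hr)
  refine h.congr_deriv ?_
  unfold outgoingPDeriv
  ring

/-- `P_N''` is the derivative of `P_N'` (`r > 0`). [cite: Costa2019, §3.2.3] -/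
theorem hasDerivAt_outgoingPDeriv (M s ω : ℝ) (c : ℕ → ℂ) (N : ℕ) {r : ℝ} (hr : 0 < r) :
    HasDerivAt (outgoingPDeriv M s ω c N) (outgoingPDeriv2 M s ω c N r) r := by
  have hrc : (r : ℂ) ≠ 0 := by exact_mod_cast hr.ne'
  have hinv : HasDerivAt (fun x : ℝ => (x : ℂ)⁻¹) (-((r : ℂ) ^ 2)⁻¹) r := by
    have := (hasDerivAt_inv hrc).comp_ofReal
    simpa using this
  have hfac : HasDerivAt (fun x : ℝ => I * ω + 2 * I * M * ω * (x : ℂ)⁻¹)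
      (2 * I * M * ω * (-((r : ℂ) ^ 2)⁻¹)) r := by
    simpa using (hinv.const_mul (2 * I * M * ω)).const_add (I * ω)
  have h := (hasDerivAt_outgoingPhase M ω hr).mul
    (((hfac.mul (hasDerivAt_outgoingSum s c N hr))).add (hasDerivAt_outgoingSumDeriv s c N hr))
  refine h.congr_deriv ?_
  unfold outgoingPDeriv2
  simp only [Pi.mul_apply, Pi.add_apply]
  field_simp
  ring

/-! ### Sizes for `r ≥ 1` -/

/-- `|e^{iωr + 2iMω log r}| = 1`. [cite: Costa2019, Def. 2.3 (footnote)] -/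
theorem norm_outgoingPhase (M ω r : ℝ) : ‖outgoingPhase M ω r‖ = 1 := norm_exp_outgoingPhase M ω r

/-- A finite sum `Σ cₖ · (real expression)ₖ` with `|termₖ| ≤ B r^e` is at most `(Σ‖cₖ‖) B r^e`.
[folklore] -/
theorem norm_sum_mul_le {c : ℕ → ℂ} {N : ℕ} {f : ℕ → ℝ} {B e r : ℝ}
    (hf : ∀ k ∈ Finset.range (N + 1), |f k| ≤ B * r ^ e) :
    ‖∑ k ∈ Finset.range (N + 1), c k * ((f k : ℝ) : ℂ)‖ ≤
      (∑ k ∈ Finset.range (N + 1), ‖c k‖) * B * r ^ e := by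
  refine (norm_sum_le _ _).trans ?_
  rw [Finset.sum_mul, Finset.sum_mul]
  refine Finset.sum_le_sum fun k hk => ?_
  rw [norm_mul, Complex.norm_real, Real.norm_eq_abs, mul_assoc]
  exact mul_le_mul_of_nonneg_left (hf k hk) (norm_nonneg _)

/-- For `r ≥ 1` and `k ≤ N`: `r^{−2s−k−j} ≤ r^{−2s}` (`j ≥ 0`). [folklore] -/
theorem rpow_expansion_le {s r : ℝ} (hr : 1 ≤ r) (k : ℕ) {j : ℝ} (hj : 0 ≤ j) :
    r ^ (-(2 * s) - (k : ℝ) - j) ≤ r ^ (-(2 * s)) :=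
  Real.rpow_le_rpow_of_exponent_le hr (by have : (0 : ℝ) ≤ k := Nat.cast_nonneg k; linarith)
set_option maxHeartbeats 400000 in -- buildfix (bf3-g27): 160k/180k FAIL, 200k PASS at accept time; line-neutral budget line
/-- **Crude sizes of `P_N, P_N', P_N''` for `r ≥ 1`**: all are `≤ C r^{−2s}`.
[cite: Costa2019, Def. 2.3] -/
theorem norm_outgoingP_le (M s ω : ℝ) (c : ℕ → ℂ) (N : ℕ) :
    ∃ C : ℝ, ∀ r, 1 ≤ r → ‖outgoingP M s ω c N r‖ ≤ C * r ^ (-(2 * s)) ∧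
      ‖outgoingPDeriv M s ω c N r‖ ≤ C * r ^ (-(2 * s)) ∧
      ‖outgoingPDeriv2 M s ω c N r‖ ≤ C * r ^ (-(2 * s)) := by
  set S : ℝ := ∑ k ∈ Finset.range (N + 1), ‖c k‖ with hS
  have hS0 : 0 ≤ S := Finset.sum_nonneg fun k _ => norm_nonneg _
  -- bounds on the coefficient factors `|−2s−k−1| ≤ 2|s| + N + 2` etc.
  set Q : ℝ := 2 * |s| + N + 3 with hQ
  have hQ0 : 1 ≤ Q := by rw [hQ]; have : (0 : ℝ) ≤ N := Nat.cast_nonneg N; nlinarith [abs_nonneg s]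
  have hq1 : ∀ k ∈ Finset.range (N + 1), |(-(2 * s) - (k : ℝ) - 1)| ≤ Q ∧ |(-(2 * s) - (k : ℝ) - 2)| ≤ Q := by
    intro k hk
    have hk' : (k : ℝ) ≤ N := by exact_mod_cast Nat.lt_succ_iff.1 (Finset.mem_range.1 hk)
    have hk0 : (0 : ℝ) ≤ k := Nat.cast_nonneg k
    constructor <;> (rw [abs_le]; constructor <;> nlinarith [abs_le.1 (le_refl |s|), neg_abs_le s, le_abs_self s])
  set W : ℝ := |ω| + 2 * |M| * |ω| with hW
  have hW0 : 0 ≤ W := by positivity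
  have hP1 : 1 ≤ (W + 1) * Q := by nlinarith
  have hWP : W ≤ (W + 1) * Q := by nlinarith
  have hQP : Q ≤ (W + 1) * Q := by nlinarith
  have hPP : (W + 1) * Q ≤ ((W + 1) * Q) ^ 2 := by nlinarith
  refine ⟨S * (5 * ((W + 1) * Q) ^ 2 + 1), fun r hr => ?_⟩
  have hr0 : 0 < r := by linarith
  have hrinv : ‖(r : ℂ)⁻¹‖ ≤ 1 := by
    rw [norm_inv, Complex.norm_real, Real.norm_eq_abs, abs_of_pos hr0]
    exact inv_le_one_of_one_le₀ hr
  have hfac : ‖I * ω + 2 * I * M * ω * (r : ℂ)⁻¹‖ ≤ W := by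
    calc ‖I * ω + 2 * I * M * ω * (r : ℂ)⁻¹‖ ≤ ‖I * (ω : ℂ)‖ + ‖2 * I * M * ω * (r : ℂ)⁻¹‖ := norm_add_le _ _
      _ ≤ |ω| + 2 * |M| * |ω| * 1 := by
          rw [norm_mul, Complex.norm_I, one_mul, Complex.norm_real, Real.norm_eq_abs]
          refine add_le_add le_rfl ?_
          rw [norm_mul, norm_mul, norm_mul, norm_mul, Complex.norm_I, Complex.norm_real,
            Complex.norm_real, Complex.norm_two, Real.norm_eq_abs, Real.norm_eq_abs]
          calc 2 * 1 * |M| * |ω| * ‖(r : ℂ)⁻¹‖ ≤ 2 * 1 * |M| * |ω| * 1 :=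
                mul_le_mul_of_nonneg_left hrinv (by positivity)
            _ = 2 * |M| * |ω| * 1 := by ring
      _ = W := by rw [hW]; ring
  -- the three sums
  have hsum : ‖outgoingSum s c N r‖ ≤ S * 1 * r ^ (-(2 * s)) := by
    unfold outgoingSum
    refine norm_sum_mul_le fun k hk => ?_
    rw [abs_of_nonneg (Real.rpow_nonneg hr0.le _), one_mul]
    exact rpow_expansion_le hr k zero_le_one
  have hsum1 : ‖outgoingSumDeriv s c N r‖ ≤ S * Q * r ^ (-(2 * s)) := by
    unfold outgoingSumDeriv
    refine norm_sum_mul_le fun k hk => ?_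
    rw [abs_mul, abs_of_nonneg (Real.rpow_nonneg hr0.le _)]
    exact mul_le_mul (hq1 k hk).1 (rpow_expansion_le hr k (by norm_num)) (Real.rpow_nonneg hr0.le _)
      (by linarith)
  have hsum2 : ‖outgoingSumDeriv2 s c N r‖ ≤ S * (Q * Q) * r ^ (-(2 * s)) := by
    unfold outgoingSumDeriv2
    refine norm_sum_mul_le fun k hk => ?_
    rw [abs_mul, abs_mul, abs_of_nonneg (Real.rpow_nonneg hr0.le _)]
    exact mul_le_mul (mul_le_mul (hq1 k hk).1 (hq1 k hk).2 (abs_nonneg _) (by linarith))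
      (rpow_expansion_le hr k (by norm_num)) (Real.rpow_nonneg hr0.le _) (by positivity)
  have hE : 0 ≤ r ^ (-(2 * s)) := Real.rpow_nonneg hr0.le _
  have hSE : 0 ≤ S * r ^ (-(2 * s)) := mul_nonneg hS0 hE
  refine ⟨?_, ?_, ?_⟩
  · unfold outgoingP
    rw [norm_mul, norm_outgoingPhase, one_mul]
    calc ‖outgoingSum s c N r‖ ≤ S * 1 * r ^ (-(2 * s)) := hsum
      _ ≤ S * (5 * ((W + 1) * Q) ^ 2 + 1) * r ^ (-(2 * s)) := by
          rw [mul_one]; refine mul_le_mul_of_nonneg_right ?_ hE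
          nlinarith [sq_nonneg ((W + 1) * Q)]
  · unfold outgoingPDeriv
    rw [norm_mul, norm_outgoingPhase, one_mul]
    calc ‖(I * ω + 2 * I * M * ω * (r : ℂ)⁻¹) * outgoingSum s c N r + outgoingSumDeriv s c N r‖ ≤
        W * (S * 1 * r ^ (-(2 * s))) + S * Q * r ^ (-(2 * s)) := by
          refine (norm_add_le _ _).trans (add_le_add ?_ hsum1)
          rw [norm_mul]; exact mul_le_mul hfac hsum (norm_nonneg _) hW0
      _ = S * (W + Q) * r ^ (-(2 * s)) := by ring
      _ ≤ S * (5 * ((W + 1) * Q) ^ 2 + 1) * r ^ (-(2 * s)) := by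
          refine mul_le_mul_of_nonneg_right (mul_le_mul_of_nonneg_left ?_ hS0) hE
          nlinarith
  · unfold outgoingPDeriv2
    rw [norm_mul, norm_outgoingPhase, one_mul]
    have hA : ‖((I * ω + 2 * I * M * ω * (r : ℂ)⁻¹) ^ 2 - 2 * I * M * ω * ((r : ℂ)⁻¹) ^ 2)‖ ≤ W ^ 2 + W := by
      calc _ ≤ ‖(I * ω + 2 * I * M * ω * (r : ℂ)⁻¹) ^ 2‖ + ‖2 * I * M * ω * ((r : ℂ)⁻¹) ^ 2‖ := norm_sub_le _ _
        _ ≤ W ^ 2 + 2 * |M| * |ω| * 1 := by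
            rw [norm_pow]
            refine add_le_add (pow_le_pow_left₀ (norm_nonneg _) hfac 2) ?_
            rw [norm_mul, norm_mul, norm_mul, norm_mul, Complex.norm_I, Complex.norm_real,
              Complex.norm_real, Complex.norm_two, Real.norm_eq_abs, Real.norm_eq_abs, norm_pow]
            calc 2 * 1 * |M| * |ω| * ‖(r : ℂ)⁻¹‖ ^ 2 ≤ 2 * 1 * |M| * |ω| * 1 := by
                  refine mul_le_mul_of_nonneg_left ?_ (by positivity)
                  exact pow_le_one₀ (norm_nonneg _) hrinv
              _ = 2 * |M| * |ω| * 1 := by ring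
        _ ≤ W ^ 2 + W := by rw [hW]; nlinarith [abs_nonneg ω, abs_nonneg M]
    calc ‖((I * ω + 2 * I * M * ω * (r : ℂ)⁻¹) ^ 2 - 2 * I * M * ω * ((r : ℂ)⁻¹) ^ 2) * outgoingSum s c N r +
          2 * (I * ω + 2 * I * M * ω * (r : ℂ)⁻¹) * outgoingSumDeriv s c N r + outgoingSumDeriv2 s c N r‖ ≤
        (W ^ 2 + W) * (S * 1 * r ^ (-(2 * s))) + 2 * W * (S * Q * r ^ (-(2 * s))) +
          S * (Q * Q) * r ^ (-(2 * s)) := by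
          refine (norm_add_le _ _).trans (add_le_add ((norm_add_le _ _).trans (add_le_add ?_ ?_)) hsum2)
          · rw [norm_mul]; exact mul_le_mul hA hsum (norm_nonneg _) (by positivity)
          · rw [norm_mul, norm_mul, Complex.norm_two]
            calc 2 * ‖I * ω + 2 * I * M * ω * (r : ℂ)⁻¹‖ * ‖outgoingSumDeriv s c N r‖ ≤
                2 * W * (S * Q * r ^ (-(2 * s))) :=
                  mul_le_mul (mul_le_mul_of_nonneg_left hfac zero_le_two) hsum1 (norm_nonneg _)
                    (by positivity)
              _ = _ := rfl
      _ = S * ((W ^ 2 + W) + 2 * W * Q + Q * Q) * r ^ (-(2 * s)) := by ring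
      _ ≤ S * (5 * ((W + 1) * Q) ^ 2 + 1) * r ^ (-(2 * s)) := by
          refine mul_le_mul_of_nonneg_right (mul_le_mul_of_nonneg_left ?_ hS0) hE
          have h1 : W ^ 2 ≤ ((W + 1) * Q) ^ 2 := pow_le_pow_left₀ hW0 hWP 2
          have h2 : Q * Q ≤ ((W + 1) * Q) ^ 2 := by
            rw [mul_pow]
            have : 1 ≤ (W + 1) ^ 2 := one_le_pow₀ (by linarith)
            nlinarith [sq_nonneg Q]
          have hQ0' : 0 ≤ Q := by linarith
          have h3 : W * Q ≤ ((W + 1) * Q) ^ 2 :=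
            (mul_le_mul_of_nonneg_right (by linarith : W ≤ W + 1) hQ0').trans hPP
          linarith

/-! ### The remainder `E_N = R − P_N` and its derivative -/

/-- **The outgoing remainder and its derivative, any spin** (TdC Def. 2.3 / Lemma 2.2 as used in
§3.2.3 and, for `s > 0`, in §2.3.2/§4.3). Let `R` be a classical radial solution (`ω ≠ 0`, any
real `s`) admitting the outgoing partial sums
`P_N` with `|R − P_N| ≤ C_N r^{−2s−N−2}` for large `r`, for every `N ≥ 1` (this is
`Kerr.IsOutgoingAtInfinity` with its coefficient sequence `c`). Then there is `K ≥ 0`,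
independent of `N`, such that for every `N ≥ max(1, −2s)`:
`|R − P_N| ≤ C r^{−2s−N−2}` and `|R' − P_N'| ≤ C r^{(−2s−N−2+K)/2}` for `r ≥ X`
(Landau's inequality on `[r, r + r^{(a−K)/2}]`, `a = −2s−N−2`). [cite: Costa2019, Def. 2.3, Lemma 2.2, §3.2.3] -/
theorem outgoing_remainder_bounds_allSpin {M a : ℝ} (hM : 0 < M) (ha : |a| < M) {s : ℝ}
    {ω : ℝ} (hω : ω ≠ 0) {m lam : ℝ} {R : ℝ → ℂ} (hsol : IsRadialTeukolskySolution M a s ω m lam R)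
    {c : ℕ → ℂ}
    (hc : ∀ N : ℕ, 1 ≤ N → ∃ C r₀ : ℝ, ∀ r, r₀ ≤ r →
      ‖R r - outgoingP M s ω c N r‖ ≤ C * r ^ (-(2 * s) - (N : ℝ) - 2)) :
    ∃ K : ℝ, 0 ≤ K ∧ ∀ N : ℕ, 1 ≤ N → -(2 * s) ≤ N →
      ∃ X C : ℝ, rPlus M a + 1 ≤ X ∧ 1 ≤ X ∧ ∀ r, X ≤ r →
        ‖R r - outgoingP M s ω c N r‖ ≤ C * r ^ (-(2 * s) - (N : ℝ) - 2) ∧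
        ‖deriv R r - outgoingPDeriv M s ω c N r‖ ≤ C * r ^ ((-(2 * s) - (N : ℝ) - 2 + K) / 2) := by
  obtain ⟨hd1, hd2, hd2c, huniq⟩ := deriv_facts_of_isRadialTeukolskySolution ha.le hsol
  -- growth of `R`, `R'`
  obtain ⟨X₀, C₀, p₀, hX₀, hX₀1, hC₀, hp₀, hgrow⟩ :=
    exists_rpow_bound_of_isRadialTeukolskySolution hM ha hω hsol hd1
  -- the normal form `R'' = p R' + q R` with bounded coefficients
  obtain ⟨p, q, Xn, C₁, C₂, hXn1, hXnr, hp, hq, hnf⟩ := radial_normalForm_bounds hM ha s ω m lam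
  obtain ⟨R', R'', hR⟩ := hnf R hsol
  have hident : ∀ r, rPlus M a < r → deriv R r = R' r ∧ deriv (deriv R) r = R'' r :=
    huniq R' R'' fun r hr => ⟨(hR r hr).1, (hR r hr).2.1⟩
  have hode : ∀ r, rPlus M a < r → deriv (deriv R) r = p r * deriv R r + q r * R r := by
    intro r hr
    rw [(hident r hr).2, (hident r hr).1]
    exact (hR r hr).2.2
  have hC₁ : 0 ≤ C₁ := by
    have h := (norm_nonneg _).trans (hp Xn le_rfl)
    exact (div_nonneg_iff.1 h).elim (fun h => h.1) fun h => absurd h.2 (not_le.2 (by linarith))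
  have hC₂ : 0 ≤ C₂ := by
    have h := (norm_nonneg _).trans (hq Xn le_rfl)
    exact (div_nonneg_iff.1 h).elim (fun h => h.1) fun h => absurd h.2 (not_le.2 (by linarith))
  -- the exponent `K = p₀ + 2|s|` and the constant for `|E''|`
  set K : ℝ := p₀ + 2 * |s| with hK
  have hK0 : 0 ≤ K := by rw [hK]; positivity
  refine ⟨K, hK0, fun N hN1 hNs => ?_⟩
  obtain ⟨CN, r₀, hCN⟩ := hc N hN1
  obtain ⟨CP, hCP⟩ := norm_outgoingP_le M s ω c N
  set X : ℝ := max (max X₀ Xn) (max r₀ (rPlus M a + 1)) with hX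
  have hXX₀ : X₀ ≤ X := (le_max_left _ _).trans (le_max_left _ _)
  have hXXn : Xn ≤ X := (le_max_right _ _).trans (le_max_left _ _)
  have hXr₀ : r₀ ≤ X := (le_max_left _ _).trans (le_max_right _ _)
  have hXrp : rPlus M a + 1 ≤ X := (le_max_right _ _).trans (le_max_right _ _)
  have hX1 : 1 ≤ X := hX₀1.trans hXX₀
  -- the exponent `a = −2s − N − 2 ≤ −2`
  set α : ℝ := -(2 * s) - (N : ℝ) - 2 with hα
  have hα2 : α ≤ -2 := by rw [hα]; linarith
  -- `|E''| ≤ B₀ r^K` for `r ≥ X`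
  set B₀ : ℝ := C₁ * C₀ + (ω ^ 2 + C₂) * C₀ + |CP| with hB₀
  have hB₀0 : 0 ≤ B₀ := by positivity
  have hE'' : ∀ r, X ≤ r → ‖deriv (deriv R) r - outgoingPDeriv2 M s ω c N r‖ ≤ B₀ * r ^ K := by
    intro r hr
    have hr1 : 1 ≤ r := hX1.trans hr
    have hr0 : 0 < r := by linarith
    have hrp : rPlus M a < r := by linarith [hXrp.trans hr]
    have hpK : r ^ p₀ ≤ r ^ K :=
      Real.rpow_le_rpow_of_exponent_le hr1 (by rw [hK]; linarith [abs_nonneg s])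
    have hsK : r ^ (-(2 * s)) ≤ r ^ K :=
      Real.rpow_le_rpow_of_exponent_le hr1 (by rw [hK]; linarith [neg_abs_le s])
    have hpr : ‖p r‖ ≤ C₁ := (hp r (hXXn.trans hr)).trans (div_le_self hC₁ hr1)
    have hqr : ‖q r‖ ≤ ω ^ 2 + C₂ := by
      have h1 := hq r (hXXn.trans hr)
      calc ‖q r‖ = ‖(q r + ω ^ 2) - ω ^ 2‖ := by ring_nf
        _ ≤ ‖q r + ω ^ 2‖ + ‖((ω : ℂ)) ^ 2‖ := norm_sub_le _ _
        _ ≤ C₂ / r + ω ^ 2 := add_le_add h1 (by rw [norm_pow, Complex.norm_real, Real.norm_eq_abs, sq_abs])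
        _ ≤ C₂ + ω ^ 2 := by linarith [div_le_self hC₂ hr1]
        _ = ω ^ 2 + C₂ := by ring
    have hRr := (hgrow r (hXX₀.trans hr)).1
    have hR'r := (hgrow r (hXX₀.trans hr)).2
    have hPr := (hCP r hr1).2.2
    rw [hode r hrp]
    calc ‖p r * deriv R r + q r * R r - outgoingPDeriv2 M s ω c N r‖ ≤
        ‖p r * deriv R r + q r * R r‖ + ‖outgoingPDeriv2 M s ω c N r‖ := norm_sub_le _ _
      _ ≤ ‖p r * deriv R r‖ + ‖q r * R r‖ + ‖outgoingPDeriv2 M s ω c N r‖ :=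
          add_le_add (norm_add_le _ _) le_rfl
      _ ≤ C₁ * (C₀ * r ^ K) + (ω ^ 2 + C₂) * (C₀ * r ^ K) + |CP| * r ^ K := by
          rw [norm_mul, norm_mul]
          refine add_le_add (add_le_add ?_ ?_) ?_
          · exact mul_le_mul hpr (hR'r.trans (mul_le_mul_of_nonneg_left hpK hC₀)) (norm_nonneg _) hC₁
          · exact mul_le_mul hqr (hRr.trans (mul_le_mul_of_nonneg_left hpK hC₀)) (norm_nonneg _)
              (by positivity)
          · exact hPr.trans ((mul_le_mul_of_nonneg_right (le_abs_self CP)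
              (Real.rpow_nonneg hr0.le _)).trans (mul_le_mul_of_nonneg_left hsK (abs_nonneg CP)))
      _ = B₀ * r ^ K := by rw [hB₀]; ring
  -- nonnegativity of `CN`
  have hCN0 : 0 ≤ CN := by
    have h := (norm_nonneg _).trans (hCN X hXr₀)
    exact le_of_mul_le_mul_right (by simpa using h) (Real.rpow_pos_of_pos (by linarith) _)
  -- continuity of `E'' = deriv (deriv R) − P_N''` on `(r₊, ∞) ∩ (0, ∞)`
  have hP2c : ContinuousOn (outgoingPDeriv2 M s ω c N) (Ioi 0) := by
    have hph : ContinuousOn (outgoingPhase M ω) (Ioi 0) := fun r hr =>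
      (hasDerivAt_outgoingPhase M ω hr).continuousAt.continuousWithinAt
    have hS0c : ContinuousOn (outgoingSum s c N) (Ioi 0) := fun r hr =>
      (hasDerivAt_outgoingSum s c N hr).continuousAt.continuousWithinAt
    have hS1c : ContinuousOn (outgoingSumDeriv s c N) (Ioi 0) := fun r hr =>
      (hasDerivAt_outgoingSumDeriv s c N hr).continuousAt.continuousWithinAt
    have hS2c : ContinuousOn (outgoingSumDeriv2 s c N) (Ioi 0) := by
      unfold outgoingSumDeriv2
      refine continuousOn_finsetSum _ fun k _ => continuousOn_const.mul ?_
      refine Complex.continuous_ofReal.comp_continuousOn (continuousOn_const.mul ?_)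
      exact ContinuousOn.rpow_const continuousOn_id fun r hr => Or.inl (ne_of_gt hr)
    have hinv : ContinuousOn (fun r : ℝ => (r : ℂ)⁻¹) (Ioi 0) :=
      (Complex.continuous_ofReal.continuousOn).inv₀ fun r hr => by exact_mod_cast (ne_of_gt hr)
    unfold outgoingPDeriv2
    have hfac : ContinuousOn (fun r : ℝ => I * ω + 2 * I * M * ω * (r : ℂ)⁻¹) (Ioi 0) :=
      continuousOn_const.add (continuousOn_const.mul hinv)
    exact hph.mul ((((((hfac.pow 2).sub (continuousOn_const.mul (hinv.pow 2))).mul hS0c).add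
      ((continuousOn_const.mul hfac).mul hS1c)).add hS2c))
  -- the main estimate
  refine ⟨X, max CN (2 * CN + B₀ * 2 ^ K / 2), hXrp, hX1, fun r hr => ?_⟩
  have hr1 : 1 ≤ r := hX1.trans hr
  have hr0 : 0 < r := by linarith
  constructor
  · exact (hCN r (hXr₀.trans hr)).trans (mul_le_mul_of_nonneg_right (le_max_left _ _)
      (Real.rpow_nonneg hr0.le _))
  -- Landau on `[r, r + h]`, `h = r^{(α − K)/2} ≤ 1`
  set h : ℝ := r ^ ((α - K) / 2) with hh
  have hhpos : 0 < h := Real.rpow_pos_of_pos hr0 _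
  have hh1 : h ≤ 1 := Real.rpow_le_one_of_one_le_of_nonpos hr1 (by linarith)
  have hIcc : ∀ t ∈ Icc r (r + h), X ≤ t ∧ 0 < t ∧ rPlus M a < t ∧ t ≤ 2 * r := fun t ht =>
    ⟨hr.trans ht.1, by linarith [ht.1], by linarith [hXrp.trans (hr.trans ht.1)], by linarith [ht.2]⟩
  set E : ℝ → ℂ := fun t => R t - outgoingP M s ω c N t with hEd
  set E' : ℝ → ℂ := fun t => deriv R t - outgoingPDeriv M s ω c N t with hE'd
  set E'' : ℝ → ℂ := fun t => deriv (deriv R) t - outgoingPDeriv2 M s ω c N t with hE''d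
  have hf : ∀ t ∈ Icc r (r + h), HasDerivAt E (E' t) t := fun t ht =>
    (hd1 t (hIcc t ht).2.2.1).sub (hasDerivAt_outgoingP M s ω c N (hIcc t ht).2.1)
  have hf' : ∀ t ∈ Icc r (r + h), HasDerivAt E' (E'' t) t := fun t ht =>
    (hd2 t (hIcc t ht).2.2.1).sub (hasDerivAt_outgoingPDeriv M s ω c N (hIcc t ht).2.1)
  have hf''c : ContinuousOn E'' (Icc r (r + h)) :=
    (hd2c.mono fun t ht => (hIcc t ht).2.2.1).sub (hP2c.mono fun t ht => (hIcc t ht).2.1)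
  have hA : ∀ t ∈ Icc r (r + h), ‖E t‖ ≤ CN * r ^ α := by
    intro t ht
    refine (hCN t (hXr₀.trans (hIcc t ht).1)).trans ?_
    exact mul_le_mul_of_nonneg_left (Real.rpow_le_rpow_of_nonpos hr0 ht.1 (by linarith)) hCN0
  have h2K : (2 * r) ^ K = 2 ^ K * r ^ K := Real.mul_rpow zero_le_two hr0.le
  have hB : ∀ t ∈ Icc r (r + h), ‖E'' t‖ ≤ B₀ * 2 ^ K * r ^ K := by
    intro t ht
    refine (hE'' t (hIcc t ht).1).trans ?_
    have h1 : t ^ K ≤ (2 * r) ^ K := Real.rpow_le_rpow (hIcc t ht).2.1.le (hIcc t ht).2.2.2 hK0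
    rw [mul_assoc, ← h2K]
    exact mul_le_mul_of_nonneg_left h1 hB₀0
  have hL := norm_deriv_le_landau hhpos hf hf' hf''c hA hB
  -- `r^α / h = r^{(α+K)/2}` and `h r^K = r^{(α+K)/2}`
  have hpow1 : r ^ α / h = r ^ ((α + K) / 2) := by
    rw [hh, div_eq_mul_inv, ← Real.rpow_neg hr0.le, ← Real.rpow_add hr0]; congr 1; ring
  have hpow2 : h * r ^ K = r ^ ((α + K) / 2) := by
    rw [hh, ← Real.rpow_add hr0]; congr 1; ring
  have hE'r : ‖E' r‖ ≤ (2 * CN + B₀ * 2 ^ K / 2) * r ^ ((α + K) / 2) := by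
    calc ‖E' r‖ ≤ 2 * (CN * r ^ α) / h + h * (B₀ * 2 ^ K * r ^ K) / 2 := hL
      _ = 2 * CN * (r ^ α / h) + B₀ * 2 ^ K / 2 * (h * r ^ K) := by ring
      _ = (2 * CN + B₀ * 2 ^ K / 2) * r ^ ((α + K) / 2) := by rw [hpow1, hpow2]; ring
  calc ‖deriv R r - outgoingPDeriv M s ω c N r‖ = ‖E' r‖ := rfl
    _ ≤ (2 * CN + B₀ * 2 ^ K / 2) * r ^ ((α + K) / 2) := hE'r
    _ ≤ max CN (2 * CN + B₀ * 2 ^ K / 2) * r ^ ((-(2 * s) - (N : ℝ) - 2 + K) / 2) := by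
        rw [hα]; exact mul_le_mul_of_nonneg_right (le_max_right _ _) (Real.rpow_nonneg hr0.le _)

/-- **The outgoing remainder and its derivative** (`s ≤ 0`; the original statement, now a
special case of `outgoing_remainder_bounds_allSpin`). [cite: Costa2019, Def. 2.3, Lemma 2.2, §3.2.3] -/
theorem outgoing_remainder_bounds {M a : ℝ} (hM : 0 < M) (ha : |a| < M) {s : ℝ} (hs : s ≤ 0)
    {ω : ℝ} (hω : ω ≠ 0) {m lam : ℝ} {R : ℝ → ℂ} (hsol : IsRadialTeukolskySolution M a s ω m lam R)
    {c : ℕ → ℂ}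
    (hc : ∀ N : ℕ, 1 ≤ N → ∃ C r₀ : ℝ, ∀ r, r₀ ≤ r →
      ‖R r - outgoingP M s ω c N r‖ ≤ C * r ^ (-(2 * s) - (N : ℝ) - 2)) :
    ∃ K : ℝ, 0 ≤ K ∧ ∀ N : ℕ, 1 ≤ N → -(2 * s) ≤ N →
      ∃ X C : ℝ, rPlus M a + 1 ≤ X ∧ 1 ≤ X ∧ ∀ r, X ≤ r →
        ‖R r - outgoingP M s ω c N r‖ ≤ C * r ^ (-(2 * s) - (N : ℝ) - 2) ∧
        ‖deriv R r - outgoingPDeriv M s ω c N r‖ ≤ C * r ^ ((-(2 * s) - (N : ℝ) - 2 + K) / 2) := by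
  have _ := hs
  exact outgoing_remainder_bounds_allSpin hM ha hω hsol hc

end Costa2019

end Literature.Geometry.Lorentzian.Kerr

end
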